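import Mathlib
import Summits.Ventures.PercRepro2.PMK5Deg5LocusClasses
import Summits.Ventures.PercRepro2.SixTerminalLocus
import Summits.Ventures.PercRepro2.Card6Locus
import Summits.Ventures.PercRepro2.BlockSubstDel

/-!
# THEOREM 31 on every graph with at most six terminals, read on the graph itself: the lead's
five exact-zero classes at the support configuration (blind cell PercRepro2, mine-2 g33)

`FiveClassG ends ω o a₁ a₂ a₃ b` is the disjunction of the lead's five exact-zero classes of
Theorem 8.1 (LEAD-SEP3.md) read on a marked graph at a configuration `ω` — trivial (`o` or `b`
connected to neither root), (SEP-2) (`{a₁, a₂}` separates `o` from `b`), (SEP-3) and its mirror,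
(A3-O), (ONE-ROOT) and its mirror — each separation being a non-connection after closing the
edges at the separating marks (`delConfig`).

* **`fiveClassG_iff_bs`**: the classes transport along a block substitution of a loop-free
  skeleton — at the terminal marks they are the classes of the skeleton at the block pattern
  (`conn_marks_iff_bs`, `conn_delConfig_marks_iff`);
* **`fiveClassG_k6_iff`**: on `K₆(M)` they are `Deg5.Locus.FiveClass15 M` (the five closure
  tables of Theorem 31, via `fiveClass15_iff`);
* **`gc_sixTerminal_pos_iff_classes`** / **`gc_sixTerminal_zero_iff_classes`** — THEOREM 31 on
  every graph with at most six terminals, stated on the graph: for admissible weights with no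
  surely connected block, `0 < Gc` iff the graph at its SUPPORT configuration (the edges of
  positive weight, `suppCfg`) is in none of the five classes, and `Gc = 0` iff it is in one;
* **`gc_card6_pos_iff_classes`** / **`gc_card6_zero_iff_classes`** — the same for every loop-free
  six-vertex graph with any edge type and any labelling, weights in `[0, 1)`.

No mask bookkeeping remains in the statements: the skeleton mask is the block pattern of the
support configuration (`bsProb_pos_iff`), packed into a bitmask by `Nat.ofBits`.  Standard axioms
only.
-/

namespace Summit.Ventures.PercRepro2

namespace BlockSubst

/-! ### The five classes on a marked graph at a configuration -/

section Classes

variable {V : Type*} {E : Type*}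

/-- **The lead's five exact-zero classes read on a marked graph at a configuration `ω`**:
trivial, (SEP-2), (SEP-3), (SEP-3′), (A3-O), (ONE-ROOT), (ONE-ROOT′) — separation = no
connection after closing the edges at the separating marks. -/
def FiveClassG (ends : E → Sym2 V) (ω : Config E) (o a₁ a₂ a₃ b : V) : Prop :=
  ((¬ Conn ends ω o a₁ ∧ ¬ Conn ends ω o a₂) ∨ (¬ Conn ends ω b a₁ ∧ ¬ Conn ends ω b a₂)) ∨
    ¬ Conn ends (delConfig ends {a₁, a₂} ω) o b ∨
    (¬ Conn ends (delConfig ends {a₁, a₃} ω) o a₂ ∧ ¬ Conn ends (delConfig ends {a₁, a₃} ω) o b) ∨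
    (¬ Conn ends (delConfig ends {a₂, a₃} ω) o a₁ ∧ ¬ Conn ends (delConfig ends {a₂, a₃} ω) o b) ∨
    (¬ Conn ends (delConfig ends {a₃} ω) o a₁ ∧ ¬ Conn ends (delConfig ends {a₃} ω) o a₂) ∨
    (¬ Conn ends (delConfig ends {a₂} ω) a₁ o ∧ ¬ Conn ends (delConfig ends {a₂} ω) a₁ b ∧
      ¬ Conn ends (delConfig ends {a₂} ω) a₁ a₃) ∨
    (¬ Conn ends (delConfig ends {a₁} ω) a₂ o ∧ ¬ Conn ends (delConfig ends {a₁} ω) a₂ b ∧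
      ¬ Conn ends (delConfig ends {a₁} ω) a₂ a₃)

variable {V' : Type*} {E' : Type*} [DecidableEq E']
variable {ends : E → Sym2 V} {ends' : E' → Sym2 V'} {q : V' → V} {blk : E → E'} {Vj : E' → Set V}

/-- **The five classes transport along a block substitution**: at the terminal marks, the classes
of the graph at `ω` are the classes of the skeleton at the block pattern. -/
theorem fiveClassG_iff_bs (hB : IsBlockSubst ends ends' q blk Vj) (hloop : ∀ j, ¬ (ends' j).IsDiag)
    (ω : Config E) (o a₁ a₂ a₃ b : V') :
    FiveClassG ends ω (q o) (q a₁) (q a₂) (q a₃) (q b) ↔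
      FiveClassG ends' (bsOpen ends ends' q blk ω) o a₁ a₂ a₃ b := by
  unfold FiveClassG
  rw [← Set.image_pair q a₁ a₂, ← Set.image_pair q a₁ a₃, ← Set.image_pair q a₂ a₃,
    ← Set.image_singleton (f := q) (a := a₃), ← Set.image_singleton (f := q) (a := a₂),
    ← Set.image_singleton (f := q) (a := a₁)]
  simp only [conn_marks_iff_bs hB, bsOpen_delConfig hB hloop]

end Classes

/-! ### The five classes on `K₆(M)` are Theorem 31's closure tables -/

section K6

open Deg5 Deg5.Locus

/-- `K₆` is loop-free. -/
lemma ends15_not_isDiag (j : Fin 15) : ¬ (ends15 j).IsDiag := by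
  unfold ends15
  rw [Sym2.mk_isDiag_iff]
  intro h
  have := ea_ne_eb j
  rw [ea_eq, eb_eq, h] at this
  exact this rfl

/-- An edge of `K₆` touches the vertex `r` iff `r` is one of its ends. -/
lemma mem_touches_ends15_iff (e : Fin 15) (r : Fin 6) :
    e ∈ touches ends15 {r} ↔ ea e = r ∨ eb e = r := by
  rw [mem_touches]
  constructor
  · rintro ⟨x, hx, y, hxy⟩
    rw [Set.mem_singleton_iff] at hx
    subst hx
    have : x ∈ ends15 e := by rw [hxy]; exact Sym2.mem_mk_left _ _
    unfold ends15 at this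
    rw [Sym2.mem_iff] at this
    rw [ea_eq, eb_eq]
    rcases this with h | h
    · exact Or.inl (by rw [h])
    · exact Or.inr (by rw [h])
  · intro h
    refine ⟨r, Set.mem_singleton r, ?_⟩
    rw [ea_eq, eb_eq] at h
    unfold ends15
    rcases h with h | h
    · exact ⟨(edge15 e).2, by rw [Fin.ext h]⟩
    · exact ⟨(edge15 e).1, by rw [Fin.ext h, Sym2.eq_swap]⟩

/-- Closing the edges at one vertex of `K₆(M)` is Theorem 31's `cfgAvoid15`. -/
lemma delConfig_ends15_singleton (M : ℕ) (r : Fin 6) :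
    delConfig ends15 {r} (cfg15 M) = cfgAvoid15 M r := by
  funext e
  by_cases h : e ∈ touches ends15 {r}
  · rw [delConfig_apply_of_mem h]
    rcases (mem_touches_ends15_iff e r).1 h with h' | h' <;> simp [cfgAvoid15, h']
  · rw [delConfig_apply_of_notMem h]
    rw [mem_touches_ends15_iff, not_or] at h
    have h1 : (ea e == (r : ℕ)) = false := beq_eq_false_iff_ne.2 h.1
    have h2 : (eb e == (r : ℕ)) = false := beq_eq_false_iff_ne.2 h.2
    simp [cfgAvoid15, cfg15, h1, h2]

/-- Closing the edges at two vertices of `K₆(M)` is Theorem 31's `cfgAvoid2_15`. -/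
lemma delConfig_ends15_pair (M : ℕ) (r s : Fin 6) :
    delConfig ends15 {r, s} (cfg15 M) = cfgAvoid2_15 M r s := by
  funext e
  have hmem : e ∈ touches ends15 {r, s} ↔
      (ea e = r ∨ eb e = r) ∨ (ea e = s ∨ eb e = s) := by
    rw [← mem_touches_ends15_iff, ← mem_touches_ends15_iff]
    simp only [mem_touches, Set.mem_insert_iff, Set.mem_singleton_iff]
    constructor
    · rintro ⟨x, hx, y, hxy⟩
      rcases hx with rfl | rfl
      · exact Or.inl ⟨x, rfl, y, hxy⟩
      · exact Or.inr ⟨x, rfl, y, hxy⟩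
    · rintro (⟨x, hx, y, hxy⟩ | ⟨x, hx, y, hxy⟩)
      · exact ⟨x, Or.inl hx, y, hxy⟩
      · exact ⟨x, Or.inr hx, y, hxy⟩
  by_cases h : e ∈ touches ends15 {r, s}
  · rw [delConfig_apply_of_mem h]
    rcases hmem.1 h with (h' | h') | (h' | h') <;> simp [cfgAvoid2_15, h']
  · rw [delConfig_apply_of_notMem h]
    rw [hmem, not_or, not_or, not_or] at h
    have h1 : (ea e == (r : ℕ)) = false := beq_eq_false_iff_ne.2 h.1.1
    have h2 : (eb e == (r : ℕ)) = false := beq_eq_false_iff_ne.2 h.1.2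
    have h3 : (ea e == (s : ℕ)) = false := beq_eq_false_iff_ne.2 h.2.1
    have h4 : (eb e == (s : ℕ)) = false := beq_eq_false_iff_ne.2 h.2.2
    simp [cfgAvoid2_15, cfg15, h1, h2, h3, h4]

/-- **On `K₆(M)` the five classes are Theorem 31's closure tables** (`FiveClass15`). -/
theorem fiveClassG_k6_iff (M : ℕ) :
    FiveClassG ends15 (cfg15 M) 0 1 2 5 4 ↔ FiveClass15 M = true := by
  rw [fiveClass15_iff]
  unfold FiveClassG TrivialP Sep2P Sep3P Sep3P' A3OP OneRootP OneRootP'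
  rw [delConfig_ends15_pair M 1 2, delConfig_ends15_pair M 1 5, delConfig_ends15_pair M 2 5,
    delConfig_ends15_singleton M 5, delConfig_ends15_singleton M 2,
    delConfig_ends15_singleton M 1]
  exact Iff.rfl

end K6

/-! ### Theorem 31 on every graph with at most six terminals, read on the graph -/

section SixTerminal

open Deg5 Deg5.Locus

variable {V : Type*} {E : Type*} [Fintype E] [DecidableEq E] {R : Type*} [Field R]
  [LinearOrder R] [IsStrictOrderedRing R]
variable {ends : E → Sym2 V} {q : Fin 6 → V} {blk : E → Fin 15} {Vj : Fin 15 → Set V}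

/-- The skeleton mask of a six-terminal graph: the block pattern of the support configuration,
as a bitmask. -/
noncomputable def suppMask (ends : E → Sym2 V) (q : Fin 6 → V) (blk : E → Fin 15) (p : E → R) :
    ℕ :=
  Nat.ofBits (bsOpen ends ends15 q blk (suppCfg p))

omit [Fintype E] [DecidableEq E] [IsStrictOrderedRing R] in
/-- The mask is below `2¹⁵`. -/
lemma suppMask_lt (p : E → R) : suppMask ends q blk p < 32768 :=
  Nat.ofBits_lt_two_pow _

omit [Fintype E] [DecidableEq E] [IsStrictOrderedRing R] in
/-- The mask reads the block pattern of the support configuration. -/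
lemma cfg15_suppMask (p : E → R) : cfg15 (suppMask ends q blk p) = bsOpen ends ends15 q blk (suppCfg p) := by
  funext j
  simp only [cfg15, suppMask]
  rw [Nat.testBit_ofBits_lt _ _ j.isLt]

/-- The blocks of the mask have positive weight, the others weight `0`. -/
lemma suppMask_testBit_iff {p : E → R} (hp : IsProbVec p) (j : Fin 15) :
    (suppMask ends q blk p).testBit j = true ↔ 0 < bsProb ends ends15 q blk p j := by
  have h := congrFun (cfg15_suppMask (ends := ends) (q := q) (blk := blk) p) j
  simp only [cfg15] at h
  rw [h, bsProb_pos_iff hp]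

/-- **THEOREM 31 on every graph with at most six terminals, on the graph — positive side**: for
admissible weights with no surely connected block, `0 < Gc` at the terminal marks iff the graph at
its support configuration is in none of the five classes. -/
theorem gc_sixTerminal_pos_iff_classes (hB : IsBlockSubst ends ends15 q blk Vj) (p : E → R)
    (hp : IsProbVec p) (hsure : ∀ j, bsProb ends ends15 q blk p j < 1) :
    0 < CovForm.Gc p ends (q 0) (q 1) (q 2) (q 5) (q 4) ↔
      ¬ FiveClassG ends (suppCfg p) (q 0) (q 1) (q 2) (q 5) (q 4) := by
  rw [gc_sixTerminal_pos_iff hB p (suppMask ends q blk p) (suppMask_lt p)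
    (fun j hj => ⟨(suppMask_testBit_iff hp j).1 hj, hsure j⟩)
    (fun j hj => by
      have : ¬ 0 < bsProb ends ends15 q blk p j := fun h =>
        Bool.false_ne_true (hj ▸ (suppMask_testBit_iff hp j).2 h)
      exact le_antisymm (not_lt.1 this) ((isProbVec_bsProb hp).nonneg j))]
  rw [fiveClassG_iff_bs hB ends15_not_isDiag, ← cfg15_suppMask, fiveClassG_k6_iff,
    Bool.not_eq_true]

/-- **THEOREM 31 on every graph with at most six terminals, on the graph — zero side**: for
admissible weights with no surely connected block, `Gc = 0` at the terminal marks iff the graph at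
its support configuration is in one of the five classes. -/
theorem gc_sixTerminal_zero_iff_classes (hB : IsBlockSubst ends ends15 q blk Vj) (p : E → R)
    (hp : IsProbVec p) (hsure : ∀ j, bsProb ends ends15 q blk p j < 1) :
    CovForm.Gc p ends (q 0) (q 1) (q 2) (q 5) (q 4) = 0 ↔
      FiveClassG ends (suppCfg p) (q 0) (q 1) (q 2) (q 5) (q 4) := by
  rw [gc_sixTerminal_zero_iff hB p (suppMask ends q blk p) (suppMask_lt p)
    (fun j hj => ⟨(suppMask_testBit_iff hp j).1 hj, hsure j⟩)
    (fun j hj => by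
      have : ¬ 0 < bsProb ends ends15 q blk p j := fun h =>
        Bool.false_ne_true (hj ▸ (suppMask_testBit_iff hp j).2 h)
      exact le_antisymm (not_lt.1 this) ((isProbVec_bsProb hp).nonneg j))]
  rw [fiveClassG_iff_bs hB ends15_not_isDiag, ← cfg15_suppMask, fiveClassG_k6_iff]

end SixTerminal

/-! ### Every six-vertex graph, any edge type, any labelling -/

section Card6

open Deg5 Deg5.Locus

variable {V : Type*} {E : Type*} [Fintype E] [DecidableEq E] {R : Type*} [Field R]
  [LinearOrder R] [IsStrictOrderedRing R]

/-- With every weight below `1`, no block of a six-vertex graph is surely connected. -/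
lemma bsProb_card6_lt_one (ι : V ≃ Fin 6) (ends : E → Sym2 V) (hloop : ∀ e, ¬ (ends e).IsDiag)
    (p : E → R) (hlt : ∀ e, p e < 1) (j : Fin 15) :
    bsProb ends ends15 ι.symm (card6Blk ι ends) p j < 1 := by
  rw [bsProb_card6 ι ends hloop, sub_lt_self_iff]
  exact Finset.prod_pos fun e _ => by linarith [hlt e]

/-- **THEOREM 31 on every six-vertex marked graph, any edge type, any labelling, on the graph —
positive side**: admissible weights below `1`; `0 < Gc` iff the graph at its support
configuration is in none of the five classes. -/
theorem gc_card6_pos_iff_classes (ι : V ≃ Fin 6) (ends : E → Sym2 V)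
    (hloop : ∀ e, ¬ (ends e).IsDiag) (p : E → R) (hp : IsProbVec p) (hlt : ∀ e, p e < 1) :
    0 < CovForm.Gc p ends (ι.symm 0) (ι.symm 1) (ι.symm 2) (ι.symm 5) (ι.symm 4) ↔
      ¬ FiveClassG ends (suppCfg p) (ι.symm 0) (ι.symm 1) (ι.symm 2) (ι.symm 5) (ι.symm 4) :=
  gc_sixTerminal_pos_iff_classes (isBlockSubst_card6 ι ends hloop) p hp
    (bsProb_card6_lt_one ι ends hloop p hlt)

/-- **THEOREM 31 on every six-vertex marked graph, any edge type, any labelling, on the graph —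
zero side**: admissible weights below `1`; `Gc = 0` iff the graph at its support configuration is
in one of the five classes. -/
theorem gc_card6_zero_iff_classes (ι : V ≃ Fin 6) (ends : E → Sym2 V)
    (hloop : ∀ e, ¬ (ends e).IsDiag) (p : E → R) (hp : IsProbVec p) (hlt : ∀ e, p e < 1) :
    CovForm.Gc p ends (ι.symm 0) (ι.symm 1) (ι.symm 2) (ι.symm 5) (ι.symm 4) = 0 ↔
      FiveClassG ends (suppCfg p) (ι.symm 0) (ι.symm 1) (ι.symm 2) (ι.symm 5) (ι.symm 4) :=
  gc_sixTerminal_zero_iff_classes (isBlockSubst_card6 ι ends hloop) p hp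
    (bsProb_card6_lt_one ι ends hloop p hlt)

end Card6

end BlockSubst

end Summit.Ventures.PercRepro2
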